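import Summits.NavierStokesRegularity.NavierStokesRegularity.Theorems.TerminalTraceTypeITraceScarL3DepthUniformBounds
import Literature.Analysis.FluidPDE.LocalTypeIScaling
import Literature.Analysis.FluidPDE.CKNScalingExtras
import Literature.Analysis.FluidPDE.AncientLimitVanishingScaled
import HarnessLib

/-!
# Depth vorticity rigidity, part 9 — CLASS-UNIFORM SCALED derivative bounds at every depth («epoch of
# regularity» (5.4)–(5.5) of Tao 2021 for extinct Type-I apices) — helper for item
# `TerminalTrace.TypeITraceScarL3` (stmt-NavierStokesRegularity-18385), stub `stub_quietShell_noConcentration`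

Seat nsreg-C26-p1 (prover), `--supports stmt-NavierStokesRegularity-18385`; planner of record nsreg-p2
g28, ROUND-26 §1c (Q2: «the whole-space epoch of regularity is free at depth»).

* `exists_uniform_depth_bounds` — there is `Kd = Kd(C, D₀) ≥ 1` such that for every `(U, P)` in
  Albritton–Barker's class on every `Q(a)` with plain pressure bound `D ≤ D₀` at apices `≤ 0` and rate
  `‖U(s)‖ ≤ C/√(−s)`, every scale `T₁ > 0` and every continuous representative `V` of `U` on the depth
  strip `]−2T₁, −T₁/4[ × ℝ³` with `C²` slices:  `‖V‖ ≤ Kd/√T₁`, `‖D_xV‖ ≤ Kd/T₁`, `‖D_x²V‖ ≤ Kd/(T₁√T₁)`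
  there.  Proof: the unit-scale class-uniform bound `exists_uniform_strip_bound` applied to the
  parabolic zoom `μU(μ²·, μ·)`, `μ = √T₁` (class invariance: `IsSuitableWeakSolutionInBall.zoomOut`,
  `cknD_nsZoom`, `Measure.quasiMeasurePreserving_smul`), the representative zoomed along, and the chain
  rule `ContinuousLinearMap.iteratedFDeriv_comp_right` for the homothety `x ↦ μ⁻¹x`.

WHAT THIS IS NOT: not the stub, not item 18385, no statement about Navier–Stokes regularity.
[folklore; AlbrittonBarker2019 §3; Tao2021 §5 (5.4)–(5.5)]
-/

noncomputable section

set_option linter.dupNamespace false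

namespace Summit.NavierStokesRegularity.NavierStokesRegularity.Theorems.TypeITraceScarL3

open MeasureTheory Set Function Filter Topology TopologicalSpace Metric InnerProductSpace
open Literature.Analysis Literature.Analysis.FluidPDE
open scoped NNReal ENNReal RealInnerProductSpace

/-- **Class-uniform scaled bounds at every depth** (see the module docstring).
[folklore; AlbrittonBarker2019 §3; Tao2021 §5 (5.4)–(5.5)] -/
theorem exists_uniform_depth_bounds (C : ℝ) (D₀ : ℝ≥0) :
    ∃ Kd : ℝ, 1 ≤ Kd ∧
    ∀ (U : ℝ → EuclideanSpace ℝ (Fin 3) → EuclideanSpace ℝ (Fin 3))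
      (P : ℝ → EuclideanSpace ℝ (Fin 3) → ℝ),
      (∀ a : ℝ, 0 < a →
        IsSuitableWeakSolutionInBall a (0 : ℝ × EuclideanSpace ℝ (Fin 3)) U P) →
      (∀ z₀ : ℝ × EuclideanSpace ℝ (Fin 3), z₀.1 ≤ 0 →
        ∀ r : ℝ, 0 < r → cknD r z₀ P ≤ D₀) →
      (∀ s : ℝ, s < 0 →
        ∀ᵐ y : EuclideanSpace ℝ (Fin 3), ‖U s y‖ ≤ C / Real.sqrt (-s)) →
      ∀ T₁ : ℝ, 0 < T₁ →
      ∀ V : ℝ → EuclideanSpace ℝ (Fin 3) → EuclideanSpace ℝ (Fin 3),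
        uncurry V =ᵐ[volume.restrict
            (Ioo (-2 * T₁) (-T₁ / 4) ×ˢ (univ : Set (EuclideanSpace ℝ (Fin 3))))] uncurry U →
        ContinuousOn (uncurry V)
          (Ioo (-2 * T₁) (-T₁ / 4) ×ˢ (univ : Set (EuclideanSpace ℝ (Fin 3)))) →
        (∀ t ∈ Ioo (-2 * T₁) (-T₁ / 4), ContDiff ℝ 2 (V t)) →
        ∀ t ∈ Ioo (-2 * T₁) (-T₁ / 4), ∀ x : EuclideanSpace ℝ (Fin 3),
          ‖V t x‖ ≤ Kd / Real.sqrt T₁ ∧ ‖fderiv ℝ (V t) x‖ ≤ Kd / T₁ ∧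
            ‖iteratedFDeriv ℝ 2 (V t) x‖ ≤ Kd / (T₁ * Real.sqrt T₁) := by
  set L : ℝ := |C| / Real.sqrt (-(-1 / 4 : ℝ)) with hLdef
  obtain ⟨Ku, hKu⟩ := exists_uniform_strip_bound L D₀
  set Kd : ℝ := max 1 Ku with hKd
  have hKuKd : Ku ≤ Kd := le_max_right _ _
  have hKd0 : 0 ≤ Kd := zero_le_one.trans (le_max_left _ _)
  refine ⟨Kd, le_max_left _ _, ?_⟩
  intro U P hsw hD hrate T₁ hT₁ V hVU hVc hV2 t ht x
  -- ### the scale `μ = √T₁` and the zoomed data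
  set μ : ℝ := Real.sqrt T₁ with hμdef
  have hμpos : 0 < μ := Real.sqrt_pos.2 hT₁
  have hμ0 : μ ≠ 0 := hμpos.ne'
  have hμ2 : 0 < μ ^ 2 := pow_pos hμpos 2
  have hμsq : μ ^ 2 = T₁ := Real.sq_sqrt hT₁.le
  set U' : ℝ → EuclideanSpace ℝ (Fin 3) → EuclideanSpace ℝ (Fin 3) :=
    μ • stPull (μ ^ 2) μ (0 : ℝ) (0 : EuclideanSpace ℝ (Fin 3)) U with hU'def
  set P' : ℝ → EuclideanSpace ℝ (Fin 3) → ℝ :=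
    μ ^ 2 • stPull (μ ^ 2) μ (0 : ℝ) (0 : EuclideanSpace ℝ (Fin 3)) P with hP'def
  set V' : ℝ → EuclideanSpace ℝ (Fin 3) → EuclideanSpace ℝ (Fin 3) :=
    μ • stPull (μ ^ 2) μ (0 : ℝ) (0 : EuclideanSpace ℝ (Fin 3)) V with hV'def
  have hU'apply : ∀ s y, U' s y = μ • U (μ ^ 2 * s) (μ • y) := fun s y => by
    rw [hU'def]; simp only [Pi.smul_apply, stPull_apply, zero_add]
  have hV'apply : ∀ s y, V' s y = μ • V (μ ^ 2 * s) (μ • y) := fun s y => by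
    rw [hV'def]; simp only [Pi.smul_apply, stPull_apply, zero_add]
  have hst0 : ∀ z : ℝ × EuclideanSpace ℝ (Fin 3),
      stAffine (μ ^ 2) μ (0 : ℝ) (0 : EuclideanSpace ℝ (Fin 3)) z = (μ ^ 2 * z.1, μ • z.2) := by
    intro z
    rw [show z = (z.1, z.2) from rfl, stAffine_apply, zero_add, zero_add]
  -- (i) the zoom is in the class
  have hsw' : ∀ a : ℝ, 0 < a →
      IsSuitableWeakSolutionInBall a (0 : ℝ × EuclideanSpace ℝ (Fin 3)) U' P' := by
    intro a ha
    have h := (hsw (a * μ) (mul_pos ha hμpos)).zoomOut hμpos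
    rwa [mul_div_cancel_right₀ a hμ0] at h
  have hD' : ∀ z₀ : ℝ × EuclideanSpace ℝ (Fin 3), z₀.1 ≤ 0 → ∀ r : ℝ, 0 < r → cknD r z₀ P' ≤ D₀ := by
    intro z₀ hz₀ r hr
    rw [hP'def, cknD_nsZoom hμpos hr 0 0 z₀ P]
    refine hD _ ?_ (μ * r) (mul_pos hμpos hr)
    rw [hst0]
    exact mul_nonpos_of_nonneg_of_nonpos hμ2.le hz₀
  have hP'1 : ∀ z₀ : ℝ × EuclideanSpace ℝ (Fin 3), z₀.1 ≤ 0 →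
      ∫⁻ q in parabolicCylinder 1 z₀, ‖P' q.1 q.2‖ₑ ^ (3 / 2 : ℝ) ≤ D₀ := by
    intro z₀ hz₀
    have h := hD' z₀ hz₀ 1 one_pos
    simpa [cknD] using h
  have hrate' : ∀ s : ℝ, s < 0 → ∀ᵐ y : EuclideanSpace ℝ (Fin 3), ‖U' s y‖ ≤ C / Real.sqrt (-s) := by
    intro s hs
    have hs2 : μ ^ 2 * s < 0 := mul_neg_of_pos_of_neg hμ2 hs
    have h := (Measure.quasiMeasurePreserving_smul volume hμ0).ae (hrate (μ ^ 2 * s) hs2)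
    filter_upwards [h] with y hy
    have hsq : Real.sqrt (-(μ ^ 2 * s)) = μ * Real.sqrt (-s) := by
      rw [show -(μ ^ 2 * s) = μ ^ 2 * (-s) by ring, Real.sqrt_mul hμ2.le, Real.sqrt_sq hμpos.le]
    rw [hU'apply, norm_smul, Real.norm_eq_abs, abs_of_pos hμpos]
    have hy' : ‖U (μ ^ 2 * s) (μ • y)‖ ≤ C / (μ * Real.sqrt (-s)) := by rw [← hsq]; exact hy
    calc μ * ‖U (μ ^ 2 * s) (μ • y)‖ ≤ μ * (C / (μ * Real.sqrt (-s))) :=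
          mul_le_mul_of_nonneg_left hy' hμpos.le
      _ = C / Real.sqrt (-s) := by field_simp
  have hbd' : ∀ᵐ z ∂(volume.restrict (Ioo ((-2 : ℝ) - 1) (-1 / 4) ×ˢ
      (univ : Set (EuclideanSpace ℝ (Fin 3))))), ‖U' z.1 z.2‖ ≤ L :=
    ae_norm_le_strip_of_rate hsw' hrate' (by norm_num)
  -- (ii) the zoomed representative
  set ST : Set (ℝ × EuclideanSpace ℝ (Fin 3)) :=
    Ioo (-2 * T₁) (-T₁ / 4) ×ˢ (univ : Set (EuclideanSpace ℝ (Fin 3))) with hSTdef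
  set S1 : Set (ℝ × EuclideanSpace ℝ (Fin 3)) :=
    Ioo (-2 : ℝ) (-1 / 4) ×ˢ (univ : Set (EuclideanSpace ℝ (Fin 3))) with hS1def
  have hmaps : ∀ z : ℝ × EuclideanSpace ℝ (Fin 3), z ∈ S1 →
      ((μ ^ 2 * z.1, μ • z.2) : ℝ × EuclideanSpace ℝ (Fin 3)) ∈ ST := by
    rintro ⟨s, y⟩ ⟨hs, -⟩
    refine ⟨⟨?_, ?_⟩, mem_univ _⟩
    · show -2 * T₁ < μ ^ 2 * s
      rw [hμsq]; nlinarith [hs.1]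
    · show μ ^ 2 * s < -T₁ / 4
      rw [hμsq]; nlinarith [hs.2]
  have hV'U' : uncurry V' =ᵐ[volume.restrict S1] uncurry U' := by
    have hSTm : MeasurableSet ST := measurableSet_Ioo.prod MeasurableSet.univ
    have hS1m : MeasurableSet S1 := measurableSet_Ioo.prod MeasurableSet.univ
    have h1 := (ae_restrict_iff' hSTm).1 hVU
    show ∀ᵐ z ∂(volume.restrict S1), uncurry V' z = uncurry U' z
    rw [ae_restrict_iff' hS1m]
    filter_upwards [(quasiMeasurePreserving_parabolicDilation hμ0).ae h1] with z hz hzS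
    have h := hz (hmaps z hzS)
    show V' z.1 z.2 = U' z.1 z.2
    rw [hV'apply, hU'apply]
    exact congrArg (fun w => μ • w) h
  have hV'c : ContinuousOn (uncurry V') S1 := by
    have hφ : Continuous fun z : ℝ × EuclideanSpace ℝ (Fin 3) =>
        ((μ ^ 2 * z.1, μ • z.2) : ℝ × EuclideanSpace ℝ (Fin 3)) := by fun_prop
    have h1 : ContinuousOn (fun z : ℝ × EuclideanSpace ℝ (Fin 3) => uncurry V (μ ^ 2 * z.1, μ • z.2)) S1 :=
      hVc.comp hφ.continuousOn fun z hz => hmaps z hz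
    exact (h1.const_smul μ).congr fun z _ => by
      show V' z.1 z.2 = μ • uncurry V (μ ^ 2 * z.1, μ • z.2)
      rw [hV'apply]; rfl
  have hbound : ∀ n ≤ 4, ∀ z ∈ S1, ‖iteratedFDeriv ℝ n (V' z.1) z.2‖ ≤ Ku :=
    hKu U' P' (-2) (-1 / 4) (by norm_num) hsw' hP'1 hbd' V' hV'U' hV'c
  -- ### the point `(s, y) = (t / T₁, μ⁻¹ x)` of the unit strip
  set s : ℝ := t / T₁ with hsdef
  have hts : μ ^ 2 * s = t := by rw [hμsq, hsdef]; field_simp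
  have hsI : s ∈ Ioo (-2 : ℝ) (-1 / 4) := by
    rw [hsdef]
    constructor
    · rw [lt_div_iff₀ hT₁]; linarith [ht.1]
    · rw [div_lt_iff₀ hT₁]; linarith [ht.2]
  set Lμ : EuclideanSpace ℝ (Fin 3) →L[ℝ] EuclideanSpace ℝ (Fin 3) :=
    (μ⁻¹ : ℝ) • ContinuousLinearMap.id ℝ (EuclideanSpace ℝ (Fin 3)) with hLμ
  have hLμ_apply : ∀ y, Lμ y = μ⁻¹ • y := fun y => rfl
  have hLμ_norm : ‖Lμ‖ ≤ μ⁻¹ := by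
    refine ContinuousLinearMap.opNorm_le_bound _ (by positivity) fun y => ?_
    rw [hLμ_apply, norm_smul, Real.norm_eq_abs, abs_of_pos (inv_pos.2 hμpos)]
  -- `V t = (μ⁻¹ • V' s) ∘ Lμ`
  have hV2' : ContDiff ℝ 2 (V' s) := by
    have h1 : ContDiff ℝ 2 (V (μ ^ 2 * s)) := by rw [hts]; exact hV2 t ht
    have h2 : ContDiff ℝ 2 (fun y : EuclideanSpace ℝ (Fin 3) => V (μ ^ 2 * s) (μ • y)) :=
      h1.comp (contDiff_const_smul μ)
    have e : V' s = fun y => μ • V (μ ^ 2 * s) (μ • y) := funext fun y => hV'apply s y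
    rw [e]
    exact h2.const_smul μ
  have hrepr : V t = (μ⁻¹ • V' s) ∘ Lμ := by
    funext y
    simp only [comp_apply, Pi.smul_apply, hLμ_apply, hV'apply, smul_smul, mul_inv_cancel₀ hμ0,
      one_smul, inv_mul_cancel₀ hμ0, hts]
  have hsz : ((s, μ⁻¹ • x) : ℝ × EuclideanSpace ℝ (Fin 3)) ∈ S1 := ⟨hsI, mem_univ _⟩
  -- ### the bounds, order by order
  have hcD : ContDiff ℝ 2 (μ⁻¹ • V' s) := hV2'.const_smul μ⁻¹
  have hkey : ∀ i : ℕ, i ≤ 2 → ‖iteratedFDeriv ℝ i (V t) x‖ ≤ μ⁻¹ * Ku * (μ⁻¹) ^ i := by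
    intro i hi
    have hi' : (i : WithTop ℕ∞) ≤ 2 := by exact_mod_cast hi
    rw [hrepr, ContinuousLinearMap.iteratedFDeriv_comp_right Lμ hcD x hi']
    refine (ContinuousMultilinearMap.norm_compContinuousLinearMap_le _ _).trans ?_
    rw [Finset.prod_const, Finset.card_univ, Fintype.card_fin]
    have h1 : ‖iteratedFDeriv ℝ i (μ⁻¹ • V' s) (Lμ x)‖ ≤ μ⁻¹ * Ku := by
      rw [iteratedFDeriv_const_smul_apply ((hV2'.of_le hi').contDiffAt), norm_smul, Real.norm_eq_abs,
        abs_of_pos (inv_pos.2 hμpos), hLμ_apply]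
      exact mul_le_mul_of_nonneg_left (hbound i (by omega) (s, μ⁻¹ • x) hsz) (by positivity)
    have h2 : ‖Lμ‖ ^ i ≤ (μ⁻¹) ^ i := pow_le_pow_left₀ (norm_nonneg _) hLμ_norm i
    have hKu0 : 0 ≤ Ku := (norm_nonneg _).trans (hbound 0 (by norm_num) (s, μ⁻¹ • x) hsz)
    exact mul_le_mul h1 h2 (by positivity) (by positivity)
  have hμinv : μ⁻¹ = 1 / Real.sqrt T₁ := by rw [hμdef, one_div]
  refine ⟨?_, ?_, ?_⟩
  · have h := hkey 0 (by norm_num)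
    rw [norm_iteratedFDeriv_zero, pow_zero, mul_one] at h
    calc ‖V t x‖ ≤ μ⁻¹ * Ku := h
      _ ≤ μ⁻¹ * Kd := mul_le_mul_of_nonneg_left hKuKd (by positivity)
      _ = Kd / Real.sqrt T₁ := by rw [hμdef]; field_simp
  · have h := hkey 1 (by norm_num)
    rw [norm_iteratedFDeriv_one, pow_one] at h
    calc ‖fderiv ℝ (V t) x‖ ≤ μ⁻¹ * Ku * μ⁻¹ := h
      _ ≤ μ⁻¹ * Kd * μ⁻¹ := by gcongr
      _ = Kd / T₁ := by rw [← hμsq]; field_simp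
  · have h := hkey 2 le_rfl
    calc ‖iteratedFDeriv ℝ 2 (V t) x‖ ≤ μ⁻¹ * Ku * μ⁻¹ ^ 2 := h
      _ ≤ μ⁻¹ * Kd * μ⁻¹ ^ 2 := by gcongr
      _ = Kd / (T₁ * Real.sqrt T₁) := by rw [← hμdef, ← hμsq]; field_simp

end Summit.NavierStokesRegularity.NavierStokesRegularity.Theorems.TypeITraceScarL3

end
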